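import Literature.AlgebraicGeometry.Resolution.NormalizationInExtensionGenericPoint
import Literature.AlgebraicGeometry.Motives.ProjectiveOfGeneratingSections
import Literature.AlgebraicGeometry.Motives.VarietiesProperProofs
import Mathlib.AlgebraicGeometry.ResidueField
import HarnessLib

/-!
# The normalization in a finite extension is normal and projective; its generic residue field is `L`

Topic: `Literature/AlgebraicGeometry/Resolution`. Companion to `NormalizationInExtension.lean`
(`normalizationIn Y L = Y^L`, `normalizationInι Y L : Y^L → Y`) and
`NormalizationInExtensionGenericPoint.lean` (`Spec L → Y^L` is a preimmersion onto the generic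
point), serving de Jong 1996, 4.16 (`DeJong1996GaloisNormalization`, `AlterationsStrictTransform.lean`):

> "Let `Y'` be the normalization of `Y` in the field `L`, then `ψ : Y' → Y` is a (finite)
> generically étale alteration of `Y`. […] Thus `Z'ᵢ → Y'` is an isomorphism as `Y'` is normal."
> (p. 71)

Everything here is PROVED (no named facts):

* `isIntegrallyClosed_stalk_normalizationIn` — **`Y^L` is normal**: its local rings are
  localisations of integral closures of the coordinate rings of `Y` in `L`, which are integrally
  closed (Liu 2002, Def. 4.1.24 / Prop. 4.1.25);
* `isProjectiveOver_normalizationIn` — **`Y^L` is projective over `k` when `Y` is** (finite over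
  the projective `Y`: E. Noether, `isFinite_normalizationInι`, and Görtz–Wedhorn I, Thm. 13.84,
  `Motives.isProjectiveOver_of_isFinite`), as required by "projective alterations" in 4.15–4.16;
* `exists_residueFieldMap_normalizationIn` — **the residue field of `Y^L` at its generic point
  is `L`, compatibly with `κ(η_Y) → L`**: for `τ : Spec L → Y^L` (Mathlib `toNormalization`) and
  `y₀ = τ(pt)`, the classifying map `κ(y₀) → L` of the `L`-point `τ` (Mathlib
  `Scheme.descResidueField (stalkClosedPointTo τ)`) is bijective, `ψ(y₀) = η_Y`, and
  `κ(η_Y) → κ(y₀) → L` is the structure map `K(Y) → L` descended to `κ(η_Y)` — read off from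
  `τ ≫ ψ = (Spec L → Spec K(Y) → Y)` through Mathlib's classification `Scheme.SpecToEquivOfField`
  of field-valued points.

## Sources

* A. J. de Jong, *Smoothness, semi-stability and alterations*, Publ. Math. IHÉS 83 (1996), 4.16
  (p. 71). [DeJong1996]
* Q. Liu, *Algebraic Geometry and Arithmetic Curves* (2002), Def. 4.1.24, Prop. 4.1.25,
  Prop. 4.1.27. [Liu2002]
* U. Görtz, T. Wedhorn, *Algebraic Geometry I* (2nd ed. 2020), Thm. 13.84. [GortzWedhorn2020]
-/

noncomputable section

open CategoryTheory AlgebraicGeometry TopologicalSpace Topology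

namespace Literature.AlgebraicGeometry.Resolution

universe u

section NormalizationInNormal

variable (Y : Scheme.{u}) [IsIntegral Y] (L : Type u) [Field L] [Algebra Y.functionField L]

/-- **The normalization of an integral scheme in a finite extension of its function field is
normal** (all local rings integrally closed): the local ring of `Y^L` at a point over the affine
open `U = Spec A` of `Y` is a localisation of `Γ(Y^L, ψ⁻¹U) ≅` the integral closure of `A` in
`Γ(Spec L, ξ_L⁻¹U) ≅ L`, which is integrally closed in its fraction field `L`
(`isFractionRing_integralClosure_sections`), and localisations of integrally closed domains are
integrally closed. [cite: Liu2002, Def. 4.1.24, p. 155] -/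
theorem isIntegrallyClosed_stalk_normalizationIn [FiniteDimensional Y.functionField L]
    (y : normalizationIn Y L) :
    IsIntegrallyClosed ((normalizationIn Y L).presheaf.stalk y) := by
  obtain ⟨_, ⟨U, hU, rfl⟩, hyU, -⟩ := Y.isBasis_affineOpens.exists_subset_of_mem_open
    (Set.mem_univ (normalizationInι Y L y)) isOpen_univ
  haveI : Nonempty U := ⟨⟨_, hyU⟩⟩
  letI algS := ((fromSpecExtension Y L).app U).hom.toAlgebra
  -- the affine open `ψ⁻¹ U` of `Y^L` and the stalk at `y` as a localisation of its sections
  have hV : IsAffineOpen (normalizationInι Y L ⁻¹ᵁ U) := hU.preimage (normalizationInι Y L)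
  haveI : Nonempty (normalizationInι Y L ⁻¹ᵁ U : (normalizationIn Y L).Opens) := ⟨⟨y, hyU⟩⟩
  letI := (normalizationIn Y L).presheaf.algebra_section_stalk
    (⟨y, hyU⟩ : ↥(normalizationInι Y L ⁻¹ᵁ U))
  haveI := hV.isLocalization_stalk ⟨y, hyU⟩
  -- `Γ(Y^L, ψ⁻¹ U) ≅ integralClosure Γ(Y, U) Γ(Spec L, ξ_L⁻¹ U)`, an integrally closed domain
  haveI := isFractionRing_integralClosure_sections Y L ⟨U, hU⟩
  haveI : IsIntegrallyClosed
      (integralClosure Γ(Y, U) Γ(Spec (.of L), fromSpecExtension Y L ⁻¹ᵁ U)) :=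
    (isIntegrallyClosed_iff_isIntegrallyClosedIn
      Γ(Spec (.of L), fromSpecExtension Y L ⁻¹ᵁ U)).mpr inferInstance
  let e₂ := ((fromSpecExtension Y L).normalizationObjIso hU).commRingCatIsoToRingEquiv
  haveI hB : IsIntegrallyClosed Γ(normalizationIn Y L, normalizationInι Y L ⁻¹ᵁ U) :=
    IsIntegrallyClosed.of_equiv e₂.symm
  -- localise
  exact isIntegrallyClosed_of_isLocalization
    ((normalizationIn Y L).presheaf.stalk
      ((⟨y, hyU⟩ : ↥(normalizationInι Y L ⁻¹ᵁ U)) : normalizationIn Y L))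
    (hV.primeIdealOf ⟨y, hyU⟩).asIdeal.primeCompl
    (hV.primeIdealOf ⟨y, hyU⟩).asIdeal.primeCompl_le_nonZeroDivisors

variable {Y} in
/-- **The normalization of a projective variety in a finite extension of its function field is
projective** (de Jong 1996, 4.15–4.16: "projective alterations `ψ : Y' → Y` […] Let `Y'` be the
normalization of `Y` in the field `L`"): `Y^L → Y ↪ ℙⁿ_k` is finite (E. Noether,
`isFinite_normalizationInι`) and `Y^L` is proper over `k`, and a proper `k`-scheme finite over
`ℙⁿ_k` is projective (Görtz–Wedhorn I, Thm. 13.84 with Cor. 13.72,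
`Motives.isProjectiveOver_of_isFinite`). [cite: DeJong1996, 4.16, p. 71] -/
theorem isProjectiveOver_normalizationIn [FiniteDimensional Y.functionField L] {k : Type u}
    [Field k] (g : Y ⟶ Spec (.of k)) (hproj : Motives.IsProjectiveOver (Over.mk g)) :
    Motives.IsProjectiveOver (Over.mk (normalizationInι Y L ≫ g)) := by
  haveI : IsProper g := Motives.IsProjectiveOver.isProper hproj
  obtain ⟨n, ι, hι⟩ := hproj
  -- the closed immersion `Y ↪ ℙⁿ_k`, retyped with source `Y`
  let ι' : Y ⟶ (Motives.projectiveSpace n k).left := ι.left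
  haveI : IsClosedImmersion ι' := hι
  have hg : ι' ≫ (Motives.projectiveSpace n k).hom = g := Over.w ι
  haveI : IsFinite (normalizationInι Y L) := isFinite_normalizationInι Y L g
  haveI : IsProper (Over.mk (normalizationInι Y L ≫ g) : Motives.SchemeOver k).hom :=
    inferInstanceAs (IsProper (normalizationInι Y L ≫ g))
  have hw : (normalizationInι Y L ≫ ι') ≫ (Motives.projectiveSpace n k).hom =
      (Over.mk (normalizationInι Y L ≫ g) : Motives.SchemeOver k).hom := by
    rw [Category.assoc, hg]
    rfl
  haveI : IsFinite (Over.homMk (normalizationInι Y L ≫ ι') hw :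
      (Over.mk (normalizationInι Y L ≫ g) : Motives.SchemeOver k) ⟶
        Motives.projectiveSpace n k).left :=
    inferInstanceAs (IsFinite (normalizationInι Y L ≫ ι'))
  exact Motives.isProjectiveOver_of_isFinite (Over.homMk (normalizationInι Y L ≫ ι') hw)

/-! ## The generic residue field of `Y^L` is `L` -/

/-- `Spec L → Spec K(Y) → Y` is `Spec` of the structure map descended to the residue field
`κ(η_Y)`, followed by `Spec κ(η_Y) → Y`. [folklore] -/
theorem fromSpecExtension_eq_SpecMap_descResidueField :
    fromSpecExtension Y L =
      Spec.map (Y.descResidueField (CommRingCat.ofHom (algebraMap Y.functionField L))) ≫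
        Y.fromSpecResidueField (genericPoint Y) := by
  rw [Scheme.descResidueField_fromSpecResidueField]
  rfl

/-- **The generic residue field of `Y^L` is `L`, compatibly with `κ(η_Y)`.** There are a
point `y₀` of `Y^L` — the image of `τ : Spec L → Y^L` (Mathlib `toNormalization`), i.e. the
generic point — and a bijective ring map `φ : κ(y₀) → L` (the classifying map of the `L`-valued
point `τ`, onto because `τ` is a preimmersion, `isPreimmersion_toNormalization`) such that
`ψ(y₀) = η_Y` and `κ(η_Y) = κ(ψ y₀) → κ(y₀) → L` is the structure map `K(Y) → L` descended to
`κ(η_Y)` — because `τ ≫ ψ = (Spec L → Spec K(Y) → Y)` and `L`-valued points of `Y` are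
classified by pairs (point, embedding of its residue field into `L`) (Mathlib
`Scheme.SpecToEquivOfField`). [cite: Liu2002, Def. 4.1.24, p. 155] -/
theorem exists_residueFieldMap_normalizationIn [FiniteDimensional Y.functionField L] :
    ∃ (y₀ : normalizationIn Y L) (φ : (normalizationIn Y L).residueField y₀ ⟶ CommRingCat.of L)
      (e : normalizationInι Y L y₀ = genericPoint Y),
      y₀ = genericPoint (normalizationIn Y L) ∧ Function.Bijective φ ∧
        (normalizationInι Y L).residueFieldMap y₀ ≫ φ =
          (Y.residueFieldCongr e).hom ≫
            Y.descResidueField (CommRingCat.ofHom (algebraMap Y.functionField L)) := by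
  let τ : Spec (.of L) ⟶ normalizationIn Y L := (fromSpecExtension Y L).toNormalization
  set ψ := normalizationInι Y L with hψ
  set y₀ : normalizationIn Y L := τ (IsLocalRing.closedPoint L) with hy₀
  set φ : (normalizationIn Y L).residueField y₀ ⟶ CommRingCat.of L :=
    (normalizationIn Y L).descResidueField (Scheme.stalkClosedPointTo τ) with hφ
  set δ : Y.residueField (genericPoint Y) ⟶ CommRingCat.of L :=
    Y.descResidueField (CommRingCat.ofHom (algebraMap Y.functionField L)) with hδ
  -- the two descriptions of the `L`-valued point `Spec L → Y`
  have hcomp : τ ≫ ψ = fromSpecExtension Y L :=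
    (fromSpecExtension Y L).toNormalization_fromNormalization
  have key : (Scheme.SpecToEquivOfField L Y).symm ⟨ψ y₀, ψ.residueFieldMap y₀ ≫ φ⟩ =
      (Scheme.SpecToEquivOfField L Y).symm ⟨genericPoint Y, δ⟩ := by
    rw [Scheme.SpecToEquivOfField_symm_apply, Scheme.SpecToEquivOfField_symm_apply]
    change Spec.map (ψ.residueFieldMap y₀ ≫ φ) ≫ Y.fromSpecResidueField (ψ y₀) =
      Spec.map δ ≫ Y.fromSpecResidueField (genericPoint Y)
    rw [Spec.map_comp, Category.assoc, Scheme.Hom.SpecMap_residueFieldMap_fromSpecResidueField,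
      ← Category.assoc, hφ, Scheme.descResidueField_stalkClosedPointTo_fromSpecResidueField,
      hcomp, hδ, fromSpecExtension_eq_SpecMap_descResidueField]
  obtain ⟨e, he⟩ := Scheme.SpecToEquivOfField_eq_iff.mp
    ((Scheme.SpecToEquivOfField L Y).symm.injective key)
  refine ⟨y₀, φ, e, toNormalization_apply Y L _, ⟨RingHom.injective _, ?_⟩, he⟩
  -- surjectivity: `τ` is a preimmersion, so `𝒪_{Y^L, y₀} → L` is onto
  haveI : IsPreimmersion τ := isPreimmersion_toNormalization Y L
  have hs : Function.Surjective (Scheme.stalkClosedPointTo τ) := by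
    intro l
    obtain ⟨s, hs⟩ := (stalkClosedPointIso (.of L)).commRingCatIsoToRingEquiv.surjective l
    obtain ⟨t, rfl⟩ := τ.stalkMap_surjective _ s
    exact ⟨t, hs⟩
  intro l
  obtain ⟨s, rfl⟩ := hs l
  refine ⟨(normalizationIn Y L).residue _ s, ?_⟩
  rw [hφ, ← CommRingCat.comp_apply, Scheme.residue_descResidueField]

end NormalizationInNormal

end Literature.AlgebraicGeometry.Resolution

end
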